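import Mathlib
import Literature.Computability.Complexity.CNF
import Summits.PneNP.PneNP.Theorems.OverlapGapAlgebraSolvableImpliesStableSectionEngine
import Summits.PneNP.PneNP.Theorems.OverlapGapAlgebraSearchHardWindowLipschitzRungDegree
import Summits.PneNP.PneNP.Theorems.OverlapGapAlgebraSolvableImpliesStableSectionLipschitzTransferBoost

/-!
# PneNP / OverlapGapAlgebra — crux `SolvableImpliesStableSection` (stmt-PneNP-2463):
# the LIPSCHITZ TRANSFER (2/2) — the crux holds for every solver with a Lipschitz section

Support for crux `stmt-PneNP-2463` (`Summit.PneNP.PneNP.Theses.OverlapGapAlgebra.SolvableImpliesStableSection`: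
"solvable in polynomial time with probability `≥ ε` ⇒ for all `η, ν, c > 0`, infinitely often an
`ηn`-stable, `νm`-valid section exists on `≥ e^{-cn}` of the Bresler–Huang interpolation path tuples").

* `sissLip_concl_of_lipschitzSolver` — for every `k ≥ 1`, `α, η, ν > 0`, every `s` with
  `s(n)² log³ n = o(n)` and every `ε > 0`: if, infinitely often in `n` (`m = ⌊α n⌋₊`), SOME map
  `g : instances → assignments` that is `s(n)`-Lipschitz in Hamming output per single-literal change
  satisfies at least `ε·#instances` instances of `F_k(n, m)`, then the conclusion of the crux holds for
  every `c > 0` — with `g` itself as the stable section.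
* `sissLip_solvableImpliesStableSection_of_lipschitz` — the crux VERBATIM with its hypothesis
  `IsPolyTime f` replaced by "eventually in `n`, the decoded section `Φ ↦ (v ↦ (f ⌜Φ⌝).getD v false)` of
  `f` is `s(n)`-Lipschitz per single-literal change" (no complexity hypothesis at all).

Mechanism (second moments only): success `≥ ε` boosts to typical `νm`-validity for Lipschitz maps
(`sissLip_km_card_invalid_le`: Efron–Stein + maximum clause-degree second moment + Chebyshev), i.e.
`(k m)·#{V_g > ν m} ≤ A(n)·#instances` with `A(n) = 4k(1 + 10 k² s(n)² log² n)/ν²`; the `ηn`-jump mass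
of `g` is ZERO once `s(n) ≤ η n`; the Bresler–Huang walk engine of line `Sketch` (`engine_count`,
validity folded into the bad edges) realises the path event on `≥ (2n)^{-4kA(n)} − (2n)^{-k²m}` of the
path tuples, and `4k A(n) log(2n) = O(log n + s² log³ n) = o(n)` (`sissLip_numerics`,
`sissLip_asy_pointwise`) makes this `≥ e^{-cn}`.

Honest scope. This is the "stable algorithms give stable sections" direction of the transfer, valid at
EVERY clause density and every `k ≥ 1`; its one non-trivial step is the boost from a single success level
`ε` to validity at all `k(mk)+1` splice points at once, which the engine reduces to an `O(1/n)`-density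
estimate that Chebyshev supplies within the `o(n / log n)` slack of the `e^{-cn}` target. With the strong
Lipschitz rung of `SearchHardWindow` (`shwLip_hardnessConjunct_lipschitz`: the same class FAILS in the
Bresler–Huang window, unconditionally) it brackets the crux: what `SolvableImpliesStableSection` asserts
beyond theorems now in the tree is exactly the transfer for polynomial-time solvers whose sections are not
`o(√(n / log³ n))`-Lipschitz.
No new definitions; axioms `propext`, `Classical.choice`, `Quot.sound`.
-/

set_option linter.dupNamespace false -- `Summit.PneNP.PneNP.…`: summit = sub-problem (D-0017)

namespace Summit.PneNP.PneNP.Theorems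

open Finset Filter Asymptotics
open scoped Classical

/-- **The Lipschitz transfer (map form).** For every `k ≥ 1`, `α, η, ν > 0`, every `s : ℕ → ℝ` with
`s(n)² log³ n = o(n)` and every `ε > 0`: if, for infinitely many `n` (with `m = ⌊α n⌋₊`), some map
`g : F_k(n,m)-instances → assignments` that is `s(n)`-Lipschitz in Hamming output per single-literal
change satisfies at least `ε·#instances` of the instances, then for every `c > 0`, infinitely often,
some map (namely such a `g` itself) is `νm`-valid at every splice point of the Bresler–Huang path and
moves by at most `η n` between consecutive splice points, on at least `e^{-cn}·#paths` of the path
tuples — the conclusion of `SolvableImpliesStableSection` at `(k, α, η, ν)`. -/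
theorem sissLip_concl_of_lipschitzSolver (k : ℕ) (hk : 1 ≤ k) (α η ν : ℝ) (hα : 0 < α)
    (hη : 0 < η) (hν : 0 < ν) (s : ℕ → ℝ)
    (hs : (fun n : ℕ => s n ^ 2 * Real.log n ^ 3) =o[atTop] (fun n : ℕ => (n : ℝ)))
    (ε : ℝ) (hε : 0 < ε)
    (hsolv : ∃ᶠ n : ℕ in atTop, ∀ m : ℕ, m = ⌊α * n⌋₊ →
      ∃ g : (Fin m → Fin k → Fin n × Bool) → (Fin n → Bool),
        (∀ (Φ : Fin m → Fin k → Fin n × Bool) (a : Fin m) (b : Fin k) (ℓ : Fin n × Bool),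
          (hammingDist (g Φ) (g (Function.update Φ a (Function.update (Φ a) b ℓ))) : ℝ) ≤ s n) ∧
        ε * Fintype.card (Fin m → Fin k → Fin n × Bool) ≤
          ((Finset.univ.filter fun Φ : Fin m → Fin k → Fin n × Bool =>
            ∀ i, ∃ j, g Φ (Φ i j).1 = (Φ i j).2).card : ℝ))
    (c : ℝ) (hc : 0 < c) :
    ∃ᶠ n : ℕ in atTop, ∀ m : ℕ, m = ⌊α * n⌋₊ →
      ∃ g : (Fin m → Fin k → Fin n × Bool) → (Fin n → Bool),
        Real.exp (-(c * n)) * Fintype.card (Fin (k + 1) → Fin m → Fin k → Fin n × Bool) ≤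
        ((Finset.univ.filter fun Ψ : Fin (k + 1) → Fin m → Fin k → Fin n × Bool =>
          let P : Fin k → ℕ → Fin m → Fin k → Fin n × Bool :=
            fun r q a b => if (a : ℕ) * k + b < q then Ψ r.succ a b else Ψ r.castSucc a b
          (∀ r : Fin k, ∀ q ≤ m * k, ((Finset.univ.filter fun i : Fin m =>
            ∀ j, g (P r q) (P r q i j).1 ≠ (P r q i j).2).card : ℝ) ≤ ν * m) ∧
          ∀ r : Fin k, ∀ q < m * k,
            (hammingDist (g (P r q)) (g (P r (q + 1))) : ℝ) ≤ η * n).card : ℝ) := by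
  have hk0 : (0 : ℝ) < k := by exact_mod_cast hk
  -- the small constant `δ`
  obtain ⟨δ, hδpos, hδ1, hδa, hδc, hδb⟩ : ∃ δ : ℝ, 0 < δ ∧ δ ≤ 1 ∧
      δ ≤ ε * ν ^ 2 * α / (160 * k ^ 2) ∧ δ ≤ c * ν ^ 2 / (1280 * k ^ 4) ∧
      δ ≤ α * ν ^ 2 / (1280 * k ^ 3) := by
    refine ⟨min 1 (min (ε * ν ^ 2 * α / (160 * k ^ 2))
      (min (c * ν ^ 2 / (1280 * k ^ 4)) (α * ν ^ 2 / (1280 * k ^ 3)))), ?_, min_le_left _ _,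
      (min_le_right _ _).trans (min_le_left _ _),
      ((min_le_right _ _).trans (min_le_right _ _)).trans (min_le_left _ _),
      ((min_le_right _ _).trans (min_le_right _ _)).trans (min_le_right _ _)⟩
    refine lt_min zero_lt_one (lt_min ?_ (lt_min ?_ ?_)) <;> positivity
  -- eventual conditions in `n`
  have C0 : ∀ᶠ n : ℕ in atTop, 3 ≤ n := eventually_ge_atTop 3
  have C1 : ∀ᶠ n : ℕ in atTop, s n ^ 2 * Real.log n ^ 3 ≤ δ * n := by
    filter_upwards [hs.def hδpos] with n hn
    rw [Real.norm_eq_abs, Real.norm_eq_abs, Nat.abs_cast] at hn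
    exact (le_abs_self _).trans hn
  have C2 := shwL_sum_maxdeg_sq_le k hα.le
  have C3 : ∀ᶠ n : ℕ in atTop, (8 + ε * ν ^ 2) * 2 / (ε * ν ^ 2 * α) ≤ (n : ℝ) :=
    tendsto_natCast_atTop_atTop.eventually_ge_atTop _
  have C4 : ∀ᶠ n : ℕ in atTop, (1 + 32 * k ^ 2 / ν ^ 2) * Real.log n ≤ c * n / 2 := by
    have hlo := Real.isLittleO_log_id_atTop.comp_tendsto tendsto_natCast_atTop_atTop
    have hK : (0 : ℝ) < 1 + 32 * k ^ 2 / ν ^ 2 := by positivity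
    have hpos : 0 < c / (2 * (1 + 32 * k ^ 2 / ν ^ 2)) := by positivity
    filter_upwards [hlo.def hpos] with n hn
    simp only [Function.comp_apply, id_eq, Real.norm_eq_abs, Nat.abs_cast] at hn
    have h1 : Real.log n ≤ c / (2 * (1 + 32 * k ^ 2 / ν ^ 2)) * n := (le_abs_self _).trans hn
    calc (1 + 32 * k ^ 2 / ν ^ 2) * Real.log n
        ≤ (1 + 32 * k ^ 2 / ν ^ 2) * (c / (2 * (1 + 32 * k ^ 2 / ν ^ 2)) * n) :=
          mul_le_mul_of_nonneg_left h1 hK.le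
      _ = c * n / 2 := by field_simp
  have C5 : ∀ᶠ n : ℕ in atTop, 2 * (16 * k ^ 2 / ν ^ 2 + 1 + k ^ 2) / (k ^ 2 * α) ≤ (n : ℝ) :=
    tendsto_natCast_atTop_atTop.eventually_ge_atTop _
  have C6 : ∀ᶠ n : ℕ in atTop, 1 / η ^ 2 ≤ (n : ℝ) :=
    tendsto_natCast_atTop_atTop.eventually_ge_atTop _
  have hev : ∀ᶠ n : ℕ in atTop, 3 ≤ n ∧ s n ^ 2 * Real.log n ^ 3 ≤ δ * n ∧
      (∀ m : ℕ, (m : ℝ) ≤ α * n →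
        ∑ Φ : Fin m → Fin k → Fin n × Bool,
            (((univ : Finset (Fin n)).sup fun v =>
              ((univ : Finset (Fin m)).filter fun i => ∃ j, (Φ i j).1 = v).card : ℕ) : ℝ) ^ 2
          ≤ 10 * Real.log n ^ 2 * Fintype.card (Fin m → Fin k → Fin n × Bool)) ∧
      (8 + ε * ν ^ 2) * 2 / (ε * ν ^ 2 * α) ≤ (n : ℝ) ∧
      (1 + 32 * k ^ 2 / ν ^ 2) * Real.log n ≤ c * n / 2 ∧
      2 * (16 * k ^ 2 / ν ^ 2 + 1 + k ^ 2) / (k ^ 2 * α) ≤ (n : ℝ) ∧ 1 / η ^ 2 ≤ (n : ℝ) := by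
    filter_upwards [C0, C1, C2, C3, C4, C5, C6] with n h0 h1 h2 h3 h4 h5 h6
    exact ⟨h0, h1, h2, h3, h4, h5, h6⟩
  refine (hsolv.and_eventually hev).mono ?_
  rintro n ⟨hn, hn3, hC1, hC2, hC3, hC4, hC5, hC6⟩ m hm
  obtain ⟨g, hg, hsucc⟩ := hn m hm
  refine ⟨g, ?_⟩
  -- numerics of `n` and `m`
  have hn1 : 1 ≤ n := le_trans (by norm_num) hn3
  have hnR : (1 : ℝ) ≤ n := by exact_mod_cast hn1
  have hxpos : (0 : ℝ) < 2 * n := by linarith only [hnR]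
  have hlog2le : Real.log 2 ≤ Real.log (2 * n) := Real.log_le_log two_pos (by linarith only [hnR])
  have hm_le : (m : ℝ) ≤ α * n := by rw [hm]; exact Nat.floor_le (by positivity)
  have hm_ge : α * n - 1 ≤ m := by
    rw [hm]; have := Nat.lt_floor_add_one (α * n); linarith only [this]
  -- a nonnegative Lipschitz constant `s' ≥ s n`
  obtain ⟨s', hs'0, hs'ge, hs'sq⟩ : ∃ s' : ℝ, 0 ≤ s' ∧ s n ≤ s' ∧ s' ^ 2 ≤ s n ^ 2 := by
    refine ⟨max (s n) 0, le_max_right _ _, le_max_left _ _, ?_⟩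
    rcases le_or_gt 0 (s n) with h | h
    · rw [max_eq_left h]
    · rw [max_eq_right h.le, zero_pow two_ne_zero]
      exact sq_nonneg _
  have hg' : ∀ (Φ : Fin m → Fin k → Fin n × Bool) (a : Fin m) (b : Fin k) (ℓ : Fin n × Bool),
      (hammingDist (g Φ) (g (Function.update Φ a (Function.update (Φ a) b ℓ))) : ℝ) ≤ s' :=
    fun Φ a b ℓ => (hg Φ a b ℓ).trans hs'ge
  have hC1' : s' ^ 2 * Real.log n ^ 3 ≤ δ * n :=
    (mul_le_mul_of_nonneg_right hs'sq (by positivity)).trans hC1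
  obtain ⟨hm1, hs'η, h8B, ht, hMB⟩ := sissLip_numerics k hk α η ν ε c δ s' hα hη hν hε hc hs'0
    hδ1 hδa hδc hδb n m hn3 hC1' hC3 hC4 hC5 hC6 hm_ge
  -- the loss rate `A` and the good set `G`
  obtain ⟨A, hA⟩ : ∃ A : ℝ, A = 4 * k * (1 + 10 * k ^ 2 * s' ^ 2 * Real.log n ^ 2) / ν ^ 2 :=
    ⟨_, rfl⟩
  have hA0 : 0 ≤ A := by rw [hA]; positivity
  rw [← hA] at ht hMB
  obtain ⟨G, hGdef⟩ : ∃ G : Finset (Fin m → Fin k → Fin n × Bool),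
      G = (univ : Finset (Fin m → Fin k → Fin n × Bool)).filter fun Φ =>
        ((((univ : Finset (Fin m)).filter fun i => ∀ j, g Φ (Φ i j).1 ≠ (Φ i j).2).card : ℕ) : ℝ)
          ≤ ν * m := ⟨_, rfl⟩
  have hval : ∀ Φ ∈ G, ((((univ : Finset (Fin m)).filter fun i =>
      ∀ j, g Φ (Φ i j).1 ≠ (Φ i j).2).card : ℕ) : ℝ) ≤ ν * m := fun Φ hΦ => by
    rw [hGdef] at hΦ
    exact (Finset.mem_filter.1 hΦ).2
  have hG : ((k * m : ℕ) : ℝ) * (Gᶜ.card : ℝ) ≤ A * Fintype.card (Fin m → Fin k → Fin n × Bool) := by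
    have h := sissLip_km_card_invalid_le hn1 hm1 g s' ν ε hs'0 hν hε hg' (hC2 m hm_le) hsucc h8B
      G hGdef
    rw [← hA] at h
    exact h
  -- zero jump mass: no single-literal change moves `g` by more than `s' ≤ η n`
  have hjump : (∑ a : Fin m, ∑ b : Fin k,
      (((Finset.univ : Finset ((Fin m → Fin k → Fin n × Bool) × (Fin n × Bool))).filter
        fun p => η * n < hammingDist (g p.1)
          (g (Function.update p.1 a (Function.update (p.1 a) b p.2)))).card : ℝ))
      ≤ A * (Fintype.card (Fin m → Fin k → Fin n × Bool) * (2 * n)) := by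
    have hzero : ∀ (a : Fin m) (b : Fin k),
        (((Finset.univ : Finset ((Fin m → Fin k → Fin n × Bool) × (Fin n × Bool))).filter
          fun p => η * n < hammingDist (g p.1)
            (g (Function.update p.1 a (Function.update (p.1 a) b p.2)))).card : ℝ) = 0 := by
      intro a b
      rw [Nat.cast_eq_zero, Finset.card_eq_zero, Finset.filter_eq_empty_iff]
      intro p _
      exact not_lt.2 ((hg' p.1 a b p.2).trans hs'η)
    simp only [hzero, Finset.sum_const_zero]
    positivity
  -- the engine and the growing-loss asymptotics
  have hE := Summit.PneNP.PneNP.Cruxes.SolvableImpliesStableSection.Sketch.engine_count k m n hn1 η A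
    hη.le hA0 g G hG hjump
  have hasym := sissLip_asy_pointwise (M := m * k) (k := k) (Real.exp_log hxpos) hlog2le ht hMB
  -- assembly (as in `concl_of_smoothSection`)
  have hpaths : (Fintype.card (Fin (k + 1) → Fin m → Fin k → Fin n × Bool) : ℝ) =
      (2 * n) ^ (m * k * (k + 1)) := by
    rw [Summit.PneNP.PneNP.Cruxes.SolvableImpliesStableSection.Sketch.eng_card_paths]
    push_cast
    ring
  have hmono : ((univ : Finset (Fin (k + 1) → Fin m → Fin k → Fin n × Bool)).filter fun Ψ =>
          (∀ r : Fin k, ∀ q ≤ m * k,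
            (fun (a : Fin m) (b : Fin k) =>
              if (a : ℕ) * k + b < q then Ψ r.succ a b else Ψ r.castSucc a b) ∈ G) ∧
          ∀ r : Fin k, ∀ q < m * k,
            (hammingDist
              (g fun (a : Fin m) (b : Fin k) =>
                if (a : ℕ) * k + b < q then Ψ r.succ a b else Ψ r.castSucc a b)
              (g fun (a : Fin m) (b : Fin k) =>
                if (a : ℕ) * k + b < q + 1 then Ψ r.succ a b else Ψ r.castSucc a b) : ℝ)
              ≤ η * n).card ≤
      ((univ : Finset (Fin (k + 1) → Fin m → Fin k → Fin n × Bool)).filter fun Ψ =>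
        let P : Fin k → ℕ → Fin m → Fin k → Fin n × Bool :=
          fun r q a b => if (a : ℕ) * k + b < q then Ψ r.succ a b else Ψ r.castSucc a b
        (∀ r : Fin k, ∀ q ≤ m * k, (((Finset.univ : Finset (Fin m)).filter fun i =>
          ∀ j, g (P r q) (P r q i j).1 ≠ (P r q i j).2).card : ℝ) ≤ ν * m) ∧
        ∀ r : Fin k, ∀ q < m * k,
          (hammingDist (g (P r q)) (g (P r (q + 1))) : ℝ) ≤ η * n).card := by
    refine Finset.card_le_card fun Ψ hΨ => ?_
    simp only [Finset.mem_filter, Finset.mem_univ, true_and] at hΨ ⊢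
    obtain ⟨hin, hjmp⟩ := hΨ
    exact ⟨fun r q hq => hval _ (hin r q hq), fun r q hq => hjmp r q hq⟩
  have hmono' := (Nat.cast_le (α := ℝ)).2 hmono
  rw [hpaths]
  linarith only [hasym, hE, hmono']

/-- **The Lipschitz transfer: `SolvableImpliesStableSection` HOLDS on the class of solvers with
Lipschitz sections.** For every `k ≥ 1`, `α, η, ν > 0` and `s` with `s(n)² log³ n = o(n)`: the crux
`SolvableImpliesStableSection` verbatim, with its hypothesis `IsPolyTime f` REPLACED by "eventually in
`n`, the decoded section `Φ ↦ (v ↦ (f ⌜Φ⌝).getD v false)` of `f` on `F_k(n, ⌊α n⌋₊)` is `s(n)`-Lipschitz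
in Hamming output per single-literal change" (no complexity hypothesis). So the transfer conjectured by
the crux is a theorem for stable solvers at every density; its open content is the transfer for
solvers whose sections are not `o(√(n / log³ n))`-Lipschitz. -/
theorem sissLip_solvableImpliesStableSection_of_lipschitz (k : ℕ) (hk : 1 ≤ k) (α η ν : ℝ)
    (hα : 0 < α) (hη : 0 < η) (hν : 0 < ν) (s : ℕ → ℝ)
    (hs : (fun n : ℕ => s n ^ 2 * Real.log n ^ 3) =o[atTop] (fun n : ℕ => (n : ℝ)))
    (hsolv : ∃ f : List Bool → List Bool,
      (∀ᶠ n : ℕ in atTop, ∀ m : ℕ, m = ⌊α * n⌋₊ →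
        ∃ g : (Fin m → Fin k → Fin n × Bool) → (Fin n → Bool),
          (∀ (Φ : Fin m → Fin k → Fin n × Bool) (v : Fin n), g Φ v =
            (f (Literature.Computability.Complexity.encodingCNF.encode (List.ofFn fun a =>
              List.ofFn fun b => (((Φ a b).1 : ℕ), (Φ a b).2)))).getD v false) ∧
          ∀ (Φ : Fin m → Fin k → Fin n × Bool) (a : Fin m) (b : Fin k) (ℓ : Fin n × Bool),
            (hammingDist (g Φ) (g (Function.update Φ a (Function.update (Φ a) b ℓ))) : ℝ) ≤ s n) ∧
      ∃ ε : ℝ, 0 < ε ∧ ∃ᶠ n : ℕ in Filter.atTop, ∀ m : ℕ, m = ⌊α * n⌋₊ → ε ≤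
        ((Finset.univ.filter fun Φ : Fin m → Fin k → Fin n × Bool => ∀ i, ∃ j,
          (f (Literature.Computability.Complexity.encodingCNF.encode (List.ofFn fun a =>
            List.ofFn fun b => (((Φ a b).1 : ℕ), (Φ a b).2)))).getD (Φ i j).1 false =
              (Φ i j).2).card : ℝ) / Fintype.card (Fin m → Fin k → Fin n × Bool))
    (c : ℝ) (hc : 0 < c) :
    ∃ᶠ n : ℕ in Filter.atTop, ∀ m : ℕ, m = ⌊α * n⌋₊ →
      ∃ g : (Fin m → Fin k → Fin n × Bool) → (Fin n → Bool),
        Real.exp (-(c * n)) * Fintype.card (Fin (k + 1) → Fin m → Fin k → Fin n × Bool) ≤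
        ((Finset.univ.filter fun Ψ : Fin (k + 1) → Fin m → Fin k → Fin n × Bool =>
          let P : Fin k → ℕ → Fin m → Fin k → Fin n × Bool :=
            fun r q a b => if (a : ℕ) * k + b < q then Ψ r.succ a b else Ψ r.castSucc a b
          (∀ r : Fin k, ∀ q ≤ m * k, ((Finset.univ.filter fun i : Fin m =>
            ∀ j, g (P r q) (P r q i j).1 ≠ (P r q i j).2).card : ℝ) ≤ ν * m) ∧
          ∀ r : Fin k, ∀ q < m * k,
            (hammingDist (g (P r q)) (g (P r (q + 1))) : ℝ) ≤ η * n).card : ℝ) := by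
  obtain ⟨f, hLip, ε, hε, hfreq⟩ := hsolv
  refine sissLip_concl_of_lipschitzSolver k hk α η ν hα hη hν s hs ε hε ?_ c hc
  refine (hfreq.and_eventually (hLip.and (eventually_ge_atTop 1))).mono ?_
  rintro n ⟨hn, hLn, hn1⟩ m hm
  obtain ⟨g, hgf, hg⟩ := hLn m hm
  refine ⟨g, hg, ?_⟩
  have h := hn m hm
  haveI : Nonempty (Fin n × Bool) := ⟨(⟨0, hn1⟩, false)⟩
  have hN : (0 : ℝ) < Fintype.card (Fin m → Fin k → Fin n × Bool) := by
    exact_mod_cast Fintype.card_pos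
  rw [le_div_iff₀ hN] at h
  have hset : ((Finset.univ.filter fun Φ : Fin m → Fin k → Fin n × Bool => ∀ i, ∃ j,
      (f (Literature.Computability.Complexity.encodingCNF.encode (List.ofFn fun a =>
        List.ofFn fun b => (((Φ a b).1 : ℕ), (Φ a b).2)))).getD (Φ i j).1 false = (Φ i j).2))
      = (Finset.univ.filter fun Φ : Fin m → Fin k → Fin n × Bool =>
          ∀ i, ∃ j, g Φ (Φ i j).1 = (Φ i j).2) := by
    refine Finset.filter_congr fun Φ _ => ?_
    simp only [hgf]
  rw [hset] at h
  exact h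

end Summit.PneNP.PneNP.Theorems
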